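import Summits.ValiantsHypothesis.ValiantsHypothesis.Theorems.GrenetZeonDualUnipotentThreeHalvesLongMassLedgerTorusInitial
import Literature.LinearAlgebra.Matrix.NilpotentSimilarToScalarMultiple

/-!
# `GrenetZeon.DualUnipotentThreeHalves` (stmt-ValiantsHypothesis-24318), R2 heavy-top instrument — the GRADED LIMIT of a nilpotent
# matrix space along a one-parameter diagonal torus: a graded nilpotent space of the SAME dimension (matrix adapter of ✓ `InitialForm.initSub`)

Experiment cell «val-heavytop-census» (D-0160), engine seat val-htc-eng-2 g3 (kernel-only lane).  The census's machine proofs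
(eng-1 BB/torus strata, lead-g2 `R4PRIME-CERT`, ROADMAP Thm C, and Level 1 of the pencil proof `lead-g2/Q1-PROOF.md` behind
Q1 «ι(7) ≤ 19», kernel port P-Q1, director-valiant R336 (5)) all start the same way: conjugate by a one-parameter torus
`D(τ) = diag(τ^{ρ_a})`, pass to the limit `V_μ = lim_{τ→0} D(τ) V D(τ)⁻¹`, and use that `V_μ` is GRADED (by the degree
`ρ_a − ρ_b` of the position `(a,b)`), has the SAME dimension, consists again of nilpotent matrices (indeed keeps `M^p = 0`), contains
the initial (lowest-degree) form of every member of `V`, and lies in every graded space containing `V`.  The tree has this for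
subspaces of a coordinate space `ι → ℂ` and torus-stable POLYNOMIAL families (val-idea-28 g5, port val-port-3 g3:
✓ `…Theorems.GrenetZeon.InitialForm.initSub`, `finrank_initSub`, `eval_eq_zero_of_mem_initSub`, `wtProj_mem_initSub…`).
THIS FILE is the matrix adapter (`ι = Fin n × Fin n`, weight `ρ_a + (R − ρ_b)`, family = entries of the `p`-th power of the
generic matrix `Matrix.mvPolynomialX`, which is torus-stable because `τ^{wt} ∘ Z = τ^R · D(τ) Z D(τ)⁻¹`):

* `conj_pow_eq` — `(D M D')^p = D M^p D'` when `D' D = D D' = 1`;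
* ★ `exists_torus_initial_subspace ρ V` — `∃ W ≤ M_n(ℂ)` with `finrank W = finrank V`; `W` graded (stable under every degree
  projection `π_d`, `d ∈ ℤ`, degree of `(a,b)` = `ρ a − ρ b`); `π_d Z ∈ W` for every `Z ∈ V` without entries of degree `< d`
  (initial forms; in particular homogeneous members of `V`); `W ≤ T` for every graded `T ≥ V`; and
  `(∀ A ∈ V, A^p = 0) → (∀ A ∈ W, A^p = 0)` for every `p`;
* `exists_torus_initial_subspace_of_isNilpotent` — the same with «all members nilpotent» in hypothesis and conclusion.

Honest framing: infrastructure for the instrument's kernel ports; nothing here proves or refutes `HeavyTopLaw`/`HeavyTopSlowLaw`,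
24318, S3 or 8062; `VP ≠ VNP` is NOT proved.  No definitions.  [folklore (Gröbner/torus degeneration); val-idea-28 g5
`InitialForm` (the coordinate-space theorem); this seat (adapter)]
-/

noncomputable section

-- single-conjunct layout: Sub = Summit, duplicated namespace component intended
set_option linter.dupNamespace false

namespace Summit.ValiantsHypothesis.ValiantsHypothesis.Theorems.GrenetZeon.HeavyTopTorusInitial

open Matrix
open Summit.ValiantsHypothesis.ValiantsHypothesis.Theorems.GrenetZeon.InitialForm

/-- Powers of a conjugate: `(D M D')^p = D M^p D'` when `D' D = 1` and `D D' = 1`. -/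
theorem conj_pow_eq {m : Type*} [Fintype m] [DecidableEq m] (D D' M : Matrix m m ℂ) (h1 : D' * D = 1) (h2 : D * D' = 1)
    (p : ℕ) : (D * M * D') ^ p = D * M ^ p * D' := by
  induction p with
  | zero => rw [pow_zero, pow_zero, Matrix.mul_one, h2]
  | succ p ih =>
    rw [pow_succ, ih, pow_succ]
    simp only [Matrix.mul_assoc]
    rw [← Matrix.mul_assoc D' D (M * D'), h1, Matrix.one_mul]

/-- A nilpotent `n × n` complex matrix satisfies `A^n = 0`. -/
theorem pow_eq_zero_of_isNilpotent {n : ℕ} (A : Matrix (Fin n) (Fin n) ℂ) (hA : IsNilpotent A) : A ^ n = 0 := by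
  have h := Matrix.aeval_self_charpoly A
  rw [Literature.LinearAlgebra.Matrix.NilpotentSimilarToScalarMultiple.charpoly_eq_X_pow_of_isNilpotent hA] at h
  simpa using h

/-- ★ **Graded limit along a diagonal torus (matrix form).**  For row weights `ρ : Fin n → ℕ` and a linear space
`V ≤ M_n(ℂ)` there is a linear space `W ≤ M_n(ℂ)` (the initial space of `V` along `τ ↦ diag(τ^ρ)`, lowest degree first,
degree of the position `(a,b)` being `ρ a − ρ b`) with: the same dimension; `W` graded; the initial form of every member of `V`
in `W`; `W` inside every graded space containing `V`; and every identity `M^p = 0` valid on `V` valid on `W`.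
[folklore; via ✓ `InitialForm.initSub` / `finrank_initSub` / `eval_eq_zero_of_mem_initSub`] -/
theorem exists_torus_initial_subspace {n : ℕ} (ρ : Fin n → ℕ) (V : Submodule ℂ (Matrix (Fin n) (Fin n) ℂ)) :
    ∃ W : Submodule ℂ (Matrix (Fin n) (Fin n) ℂ),
      Module.finrank ℂ W = Module.finrank ℂ V ∧
      (∀ A ∈ W, ∀ d : ℤ, (Matrix.of fun a b => if (ρ a : ℤ) - ρ b = d then A a b else 0) ∈ W) ∧
      (∀ Z ∈ V, ∀ d : ℤ, (∀ a b, (ρ a : ℤ) - ρ b < d → Z a b = 0) →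
        (Matrix.of fun a b => if (ρ a : ℤ) - ρ b = d then Z a b else 0) ∈ W) ∧
      (∀ T : Submodule ℂ (Matrix (Fin n) (Fin n) ℂ), V ≤ T →
        (∀ A ∈ T, ∀ d : ℤ, (Matrix.of fun a b => if (ρ a : ℤ) - ρ b = d then A a b else 0) ∈ T) → W ≤ T) ∧
      (∀ p : ℕ, (∀ A ∈ V, A ^ p = 0) → ∀ A ∈ W, A ^ p = 0) := by
  classical
  -- weights on positions: `wt (a,b) = ρ a + (R - ρ b)`, `R = max ρ`
  set R : ℕ := Finset.univ.sup ρ with hR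
  have hρR : ∀ a, ρ a ≤ R := fun a => Finset.le_sup (f := ρ) (Finset.mem_univ a)
  let wt : Fin n × Fin n → ℕ := fun e => ρ e.1 + (R - ρ e.2)
  have hwt : ∀ a b : Fin n, ((wt (a, b) : ℕ) : ℤ) = (ρ a : ℤ) - ρ b + R := by
    intro a b
    have hb := hρR b
    simp only [wt, Nat.cast_add, Nat.cast_sub hb]
    ring
  have hwt_le : ∀ e : Fin n × Fin n, wt e < 2 * R + 1 := by
    intro e
    have h1 := hρR e.1
    simp only [wt]
    omega
  -- the currying equivalence `(Fin n × Fin n → ℂ) ≃ M_n(ℂ)`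
  let cur : (Fin n × Fin n → ℂ) ≃ₗ[ℂ] Matrix (Fin n) (Fin n) ℂ :=
    (LinearEquiv.curry ℂ ℂ (Fin n) (Fin n)).trans (Matrix.ofLinearEquiv ℂ)
  have cur_apply : ∀ v a b, cur v a b = v (a, b) := fun v a b => rfl
  have cur_symm_apply : ∀ (A : Matrix (Fin n) (Fin n) ℂ) (e : Fin n × Fin n), cur.symm A e = A e.1 e.2 :=
    fun A e => rfl
  -- the transported space, its initial space, and the transport back
  let K : Submodule ℂ (Fin n × Fin n → ℂ) := V.map (cur.symm : Matrix (Fin n) (Fin n) ℂ →ₗ[ℂ] (Fin n × Fin n → ℂ))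
  let W : Submodule ℂ (Matrix (Fin n) (Fin n) ℂ) := (initSub wt K).map (cur : (Fin n × Fin n → ℂ) →ₗ[ℂ] _)
  have memK : ∀ Z ∈ V, cur.symm Z ∈ K := fun Z hZ => Submodule.mem_map_of_mem hZ
  have memK' : ∀ v ∈ K, cur v ∈ V := by
    rintro v ⟨Z, hZ, rfl⟩
    simpa using hZ
  have memW : ∀ s ∈ initSub wt K, cur s ∈ W := fun s hs => Submodule.mem_map_of_mem hs
  -- degree projections vs weight projections
  have proj_eq : ∀ (v : Fin n × Fin n → ℂ) (d : ℤ), 0 ≤ d + R →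
      (Matrix.of fun a b => if (ρ a : ℤ) - ρ b = d then cur v a b else 0) = cur (wtProj wt (d + R).toNat v) := by
    intro v d hd
    ext a b
    simp only [Matrix.of_apply, cur_apply, wtProj]
    have h1 : ((ρ a : ℤ) - ρ b = d) ↔ (wt (a, b) = (d + R).toNat) := by
      have := hwt a b
      omega
    by_cases h : (ρ a : ℤ) - ρ b = d
    · rw [if_pos h, if_pos (h1.1 h)]
    · rw [if_neg h, if_neg (fun h' => h (h1.2 h'))]
  have proj_zero : ∀ (A : Matrix (Fin n) (Fin n) ℂ) (d : ℤ), d + R < 0 →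
      (Matrix.of fun a b => if (ρ a : ℤ) - ρ b = d then A a b else 0) = 0 := by
    intro A d hd
    ext a b
    simp only [Matrix.of_apply, Matrix.zero_apply]
    have hb := hρR b
    rw [if_neg (by omega)]
  refine ⟨W, ?_, ?_, ?_, ?_, ?_⟩
  · -- dimension
    rw [LinearEquiv.finrank_map_eq, finrank_initSub, LinearEquiv.finrank_map_eq]
  · -- graded
    rintro A ⟨s, hs, rfl⟩ d
    by_cases hd : 0 ≤ d + R
    · rw [show (cur : (Fin n × Fin n → ℂ) →ₗ[ℂ] _) s = cur s from rfl, proj_eq s d hd]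
      exact memW _ (wtProj_mem_initSub hs _)
    · rw [proj_zero _ d (by omega)]
      exact W.zero_mem
  · -- initial forms of members of `V`
    intro Z hZ d hlow
    by_cases hd : 0 ≤ d + R
    · have hsupp : SuppGe wt (d + R).toNat (cur.symm Z) := by
        rintro ⟨a, b⟩ he
        rw [cur_symm_apply]
        show Z a b = 0
        apply hlow
        have := hwt a b
        omega
      have h1 := memW _ (wtProj_mem_initSub_of_mem (memK Z hZ) hsupp)
      rw [← proj_eq (cur.symm Z) d hd] at h1
      simpa using h1
    · rw [proj_zero _ d (by omega)]
      exact W.zero_mem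
  · -- inside every graded space containing `V`
    intro T hVT hT
    rintro A ⟨s, hs, rfl⟩
    obtain ⟨t, ht, hsupp, hse⟩ := hs
    have hsum : (cur : (Fin n × Fin n → ℂ) →ₗ[ℂ] _) s =
        ∑ c ∈ Finset.range (2 * R + 1), Matrix.of fun a b => if (ρ a : ℤ) - ρ b = (c : ℤ) - R then cur (t c) a b else 0 := by
      ext a b
      rw [show (cur : (Fin n × Fin n → ℂ) →ₗ[ℂ] _) s = cur s from rfl, cur_apply, hse, Matrix.sum_apply]
      simp only [Matrix.of_apply, cur_apply]
      have h1 : ∀ c : ℕ, ((ρ a : ℤ) - ρ b = (c : ℤ) - R) ↔ (c = wt (a, b)) := by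
        intro c; have := hwt a b; omega
      simp only [h1]
      rw [Finset.sum_ite_eq' (Finset.range (2 * R + 1)) (wt (a, b)) (fun c => t c (a, b)), if_pos]
      exact Finset.mem_range.2 (hwt_le (a, b))
    rw [hsum]
    refine T.sum_mem fun c _ => ?_
    exact hT _ (hVT (memK' _ (ht c))) _
  · -- `M^p = 0` is preserved
    intro p hV
    rintro A ⟨s, hs, rfl⟩
    rw [show (cur : (Fin n × Fin n → ℂ) →ₗ[ℂ] _) s = cur s from rfl]
    -- the torus-stable polynomial family: entries of the `p`-th power of the generic matrix
    set F : Matrix (Fin n) (Fin n) (MvPolynomial (Fin n × Fin n) ℂ) := (mvPolynomialX (Fin n) (Fin n) ℂ) ^ p with hF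
    have hFeval : ∀ v : Fin n × Fin n → ℂ, F.map (MvPolynomial.eval v) = (cur v) ^ p := by
      intro v
      have h1 : (mvPolynomialX (Fin n) (Fin n) ℂ).map (MvPolynomial.eval v) = cur v := by
        ext a b; simp [cur_apply]
      rw [hF]
      change (MvPolynomial.eval v).mapMatrix ((mvPolynomialX (Fin n) (Fin n) ℂ) ^ p) = _
      rw [map_pow]
      change ((mvPolynomialX (Fin n) (Fin n) ℂ).map (MvPolynomial.eval v)) ^ p = _
      rw [h1]
    -- torus stability: `τ^{wt} ∘ Z = τ^R • D Z D'`
    have hK : ∀ τ : ℂ, τ ≠ 0 → ∀ v ∈ K, ∀ G ∈ Set.range (fun e : Fin n × Fin n => F e.1 e.2),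
        MvPolynomial.eval (torusAct wt τ v) G = 0 := by
      intro τ hτ v hv G hG
      obtain ⟨e, rfl⟩ := hG
      have hZ : (cur v) ^ p = 0 := hV _ (memK' v hv)
      set D : Matrix (Fin n) (Fin n) ℂ := diagonal fun a => τ ^ (ρ a) with hD
      set D' : Matrix (Fin n) (Fin n) ℂ := diagonal fun a => (τ⁻¹) ^ (ρ a) with hD'
      have hDD' : D * D' = 1 := by
        rw [hD, hD', diagonal_mul_diagonal, ← diagonal_one]
        congr 1; funext a
        rw [← mul_pow, mul_inv_cancel₀ hτ, one_pow]
      have hD'D : D' * D = 1 := by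
        rw [hD, hD', diagonal_mul_diagonal, ← diagonal_one]
        congr 1; funext a
        rw [← mul_pow, inv_mul_cancel₀ hτ, one_pow]
      have hconj : cur (torusAct wt τ v) = τ ^ R • (D * cur v * D') := by
        ext a b
        rw [cur_apply]
        simp only [torusAct, Matrix.smul_apply, smul_eq_mul, hD, hD', diagonal_mul, mul_diagonal, cur_apply, wt]
        have hb := hρR b
        have e1 : τ ^ (ρ a + (R - ρ b)) = τ ^ R * (τ ^ ρ a * (τ⁻¹) ^ ρ b) := by
          have e2 : τ ^ R = τ ^ (R - ρ b) * τ ^ ρ b := by rw [← pow_add, Nat.sub_add_cancel hb]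
          have e3 : τ ^ ρ b * (τ⁻¹) ^ ρ b = 1 := by rw [← mul_pow, mul_inv_cancel₀ hτ, one_pow]
          rw [pow_add, e2]
          calc τ ^ ρ a * τ ^ (R - ρ b) = τ ^ ρ a * τ ^ (R - ρ b) * (τ ^ ρ b * (τ⁻¹) ^ ρ b) := by
                rw [e3, mul_one]
            _ = τ ^ (R - ρ b) * τ ^ ρ b * (τ ^ ρ a * (τ⁻¹) ^ ρ b) := by ring
        rw [e1]; ring
      have h1 : F.map (MvPolynomial.eval (torusAct wt τ v)) = 0 := by
        rw [hFeval, hconj, smul_pow, conj_pow_eq D D' _ hD'D hDD', hZ, Matrix.mul_zero, Matrix.zero_mul, smul_zero]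
      have h2 := congr_fun (congr_fun h1 e.1) e.2
      simpa using h2
    -- conclusion through the initial-form lemma
    ext a b
    have h1 := eval_eq_zero_of_mem_initSub wt K _ hK hs (F := F a b) ⟨(a, b), rfl⟩
    have h2 := congr_fun (congr_fun (hFeval s) a) b
    rw [Matrix.map_apply] at h2
    rw [← h2, h1, Matrix.zero_apply]

/-- **Graded limit, nilpotent form.**  As `exists_torus_initial_subspace`, with «every member is nilpotent» carried from `V` to
`W` (a nilpotent `n × n` matrix has `A^n = 0`). -/
theorem exists_torus_initial_subspace_of_isNilpotent {n : ℕ} (ρ : Fin n → ℕ) (V : Submodule ℂ (Matrix (Fin n) (Fin n) ℂ))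
    (hV : ∀ A ∈ V, IsNilpotent A) :
    ∃ W : Submodule ℂ (Matrix (Fin n) (Fin n) ℂ),
      Module.finrank ℂ W = Module.finrank ℂ V ∧
      (∀ A ∈ W, ∀ d : ℤ, (Matrix.of fun a b => if (ρ a : ℤ) - ρ b = d then A a b else 0) ∈ W) ∧
      (∀ Z ∈ V, ∀ d : ℤ, (∀ a b, (ρ a : ℤ) - ρ b < d → Z a b = 0) →
        (Matrix.of fun a b => if (ρ a : ℤ) - ρ b = d then Z a b else 0) ∈ W) ∧
      (∀ T : Submodule ℂ (Matrix (Fin n) (Fin n) ℂ), V ≤ T →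
        (∀ A ∈ T, ∀ d : ℤ, (Matrix.of fun a b => if (ρ a : ℤ) - ρ b = d then A a b else 0) ∈ T) → W ≤ T) ∧
      (∀ A ∈ W, IsNilpotent A) ∧ (∀ p : ℕ, (∀ A ∈ V, A ^ p = 0) → ∀ A ∈ W, A ^ p = 0) := by
  obtain ⟨W, h1, h2, h3, h4, h5⟩ := exists_torus_initial_subspace ρ V
  exact ⟨W, h1, h2, h3, h4, fun A hA => ⟨n, h5 n (fun B hB => pow_eq_zero_of_isNilpotent B (hV B hB)) A hA⟩, h5⟩

end Summit.ValiantsHypothesis.ValiantsHypothesis.Theorems.GrenetZeon.HeavyTopTorusInitial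

end
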